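import Summits.ResolutionOfSingularities.KangarooAtlas.MizutaniInvFormsSplit
import Summits.ResolutionOfSingularities.KangarooAtlas.MizutaniPowWitness
import Summits.ResolutionOfSingularities.KangarooAtlas.MizutaniTowerIdeals
import Mathlib.LinearAlgebra.LinearIndependent.BaseChange
import HarnessLib

/-!
# Mizutani's conjecture `m(e) = 2p^e − 1` — level bookkeeping for the invariant additive forms

Cell topic `Summits/ResolutionOfSingularities/KangarooAtlas` (pub-rosobs); namespace
`Summit.ResolutionOfSingularities.KangarooAtlas.Mizutani`.  Part of the Lean transcription of the
in-house note MIZUTANI-PROOF-g59 (AI-written, AI-audited; *AI review is weaker than expert review*; not a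
resolution theorem).  §3 DICTIONARY, small facts used by the assembly (`MizutaniLowerBound`):

* `finrank_span_frobVec_image` — `dim_k span_k F^m(N) = dim_k N` for a subspace `N ⊆ k^{n+1}` (vectors with
  entries in `k^{p^m}`, independent over `k^{p^m}`, stay independent over `k`), hence
  `hsDimAt_eq_of_exponentLE`: the dimension of `B(𝔭)` read at any level `e₀ ≥ exponent` is the same
  (Oda: "the dimension of `B(𝔭)` equals the rank of `L/L_B` as a module over `k[F]`");
* `one_le_hsDimAt` — `dim B(𝔭) ≥ 1` for a point (`𝔭 ⊉ S_+`); `exists_exact_exponent`;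
* `ideal_eq_bot_of_finite` — over a FINITE field the diagonal ideal of `k ⊗_{k^{p^e}} k` vanishes (genuine
  tensors force `k` infinite);
* `tensorIncl_injective` and `map_frobPowerIdeal_pow_le` — passage between `k ⊗_K k` and `F ⊗_K F`.

References: [Oda1983HironakaGroupSchemeII] §2 (p. 1168); [Mizutani1973HironakaGroupSchemes] Thm. 1.3, Remark 2.10.
-/

open MvPolynomial TensorProduct Literature.AlgebraicGeometry.Resolution.HironakaScheme

namespace Summit.ResolutionOfSingularities.KangarooAtlas.Mizutani

universe u

section Level

variable (k : Type u) [Field k] (p : ℕ) [Fact p.Prime] [CharP k p] {n : ℕ}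

/-- The Frobenius image of a `k`-independent family of vectors is `k`-independent.
[cite: Oda1983HironakaGroupSchemeII, §2 (p. 1168: F is injective semilinear on L)] -/
theorem linearIndependent_frobVec (m : ℕ) {d : ℕ} (v : Fin d → Fin (n + 1) → k) (hv : LinearIndependent k v) :
    LinearIndependent k fun l => frobVec k p m (v l) := by
  classical
  set w : Fin d → Fin (n + 1) → frobPow k p m := fun l i => ⟨v l i ^ p ^ m, pow_mem_frobPow m _⟩ with hw
  have hwF : (fun l => frobVec k p m (v l)) = fun l => algebraMap (frobPow k p m) k ∘ w l := by
    funext l i; rfl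
  -- `w` is independent over `K_m`: take `p^m`-th roots of a relation
  have hwli : LinearIndependent (frobPow k p m) w := by
    refine Fintype.linearIndependent_iff.mpr fun g hg l => ?_
    have hy : ∀ l', ∃ y : k, y ^ p ^ m = ((g l' : frobPow k p m) : k) := fun l' => mem_frobPow_iff.mp (g l').2
    choose y hy using hy
    have hsum : ∑ l', y l' • v l' = 0 := by
      funext i
      have hi := congrArg (fun u : Fin (n + 1) → frobPow k p m => (frobPow k p m).subtype (u i)) hg
      simp only [Finset.sum_apply, Pi.smul_apply, smul_eq_mul, map_sum, map_mul, Pi.zero_apply, map_zero] at hi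
      have hpow : (∑ l', y l' * v l' i) ^ p ^ m = 0 := by
        rw [sum_pow_char_pow, ← hi]
        refine Finset.sum_congr rfl fun l' _ => ?_
        rw [mul_pow, hy]
        rfl
      rw [Finset.sum_apply, Pi.zero_apply]
      simpa only [Pi.smul_apply, smul_eq_mul] using
        (pow_eq_zero_iff (pow_ne_zero m (Fact.out : p.Prime).ne_zero)).mp hpow
    have hy0 := Fintype.linearIndependent_iff.mp hv y hsum l
    apply Subtype.ext
    rw [← hy l, hy0, zero_pow (pow_ne_zero m (Fact.out : p.Prime).ne_zero)]
    rfl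
  rw [hwF]
  exact (linearIndependent_algebraMap_comp_iff (S := k)).mpr hwli

/-- **`dim_k span_k F^m(N) = dim_k N`** for a subspace `N ⊆ k^{n+1}`.
[cite: Oda1983HironakaGroupSchemeII, §2 (p. 1168: "the rank of L/L_B as a module over k[F]")] -/
theorem finrank_span_frobVec_image (m : ℕ) (N : Submodule k (Fin (n + 1) → k)) :
    Module.finrank k (Submodule.span k (frobVec k p m '' (N : Set (Fin (n + 1) → k)))) = Module.finrank k N := by
  classical
  let b := Module.finBasis k N
  set v : Fin (Module.finrank k N) → Fin (n + 1) → k := fun l => (b l : Fin (n + 1) → k) with hv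
  have hvli : LinearIndependent k v := b.linearIndependent.map' N.subtype (Submodule.ker_subtype N)
  have hN : Submodule.span k (Set.range v) = N := by
    have h1 := congrArg (Submodule.map N.subtype) b.span_eq
    rw [Submodule.map_span, Submodule.map_top, Submodule.range_subtype, ← Set.range_comp] at h1
    exact h1
  have hspan : Submodule.span k (frobVec k p m '' (N : Set (Fin (n + 1) → k))) =
      Submodule.span k (Set.range fun l => frobVec k p m (v l)) := by
    conv_lhs => rw [← hN]
    rw [span_image_frobVec_span, ← Set.range_comp]
    rfl
  rw [hspan, finrank_span_eq_card (linearIndependent_frobVec k p m v hvli), Fintype.card_fin]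

variable (𝔭 : Ideal (MvPolynomial (Fin (n + 1)) k))

/-- **The dimension of `B(𝔭)` does not depend on the level `e₀ ≥ exponent` at which it is read.**
[cite: Oda1983HironakaGroupSchemeII, §2 (p. 1168: dim B(𝔭) = rank of L/L_B over k[F]); Mizutani1973HironakaGroupSchemes, Thm. 1.3] -/
theorem hsDimAt_eq_of_exponentLE {e e₀ : ℕ} (hE : ExponentLE k p 𝔭 e) (h : e ≤ e₀) :
    hsDimAt k p 𝔭 e₀ = hsDimAt k p 𝔭 e := by
  unfold hsDimAt
  rw [hE e₀ h, finrank_span_frobVec_image]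

/-- The irrelevant ideal is contained in any ideal containing all the variables. [folklore] -/
theorem irrelevant_le_of_X_mem {I : Ideal (MvPolynomial (Fin (n + 1)) k)} (hX : ∀ i, (X i : MvPolynomial (Fin (n + 1)) k) ∈ I) :
    irrelevant k n ≤ I := by
  intro f hf
  have hf0 : constantCoeff f = 0 := hf
  have hmem : f ∈ Ideal.span ((fun i => (X i : MvPolynomial (Fin (n + 1)) k)) '' Set.univ) := by
    rw [MvPolynomial.mem_ideal_span_X_image]
    intro m hm
    have hm0 : m ≠ 0 := by
      rintro rfl
      rw [mem_support_iff] at hm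
      exact hm hf0
    obtain ⟨i, hi⟩ : ∃ i, m i ≠ 0 := by
      by_contra hall
      push Not at hall
      exact hm0 (Finsupp.ext hall)
    exact ⟨i, Set.mem_univ i, hi⟩
  refine (Ideal.span_le.mpr ?_) hmem
  rintro _ ⟨i, -, rfl⟩
  exact hX i

/-- **`dim B(𝔭) ≥ 1` for a point**: the invariant forms of degree `p^e` never fill `L_e` (else every
`X_i^{p^e} ∈ 𝔭`, so `𝔭 ⊇ S_+`). [cite: Oda1983HironakaGroupSchemeII, §2 (p. 1168: 𝔭 ≠ S_+)] -/
theorem one_le_hsDimAt (hP : IsPoint k 𝔭) (e : ℕ) : 1 ≤ hsDimAt k p 𝔭 e := by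
  classical
  unfold hsDimAt
  have hlt : invForms k p 𝔭 e < ⊤ := by
    rw [lt_top_iff_ne_top]
    intro htop
    apply hP.2.2
    refine irrelevant_le_of_X_mem k fun i => ?_
    set v : Fin (n + 1) → k := Pi.single i 1 with hv
    have hmem : v ∈ invForms k p 𝔭 e := by rw [htop]; exact Submodule.mem_top
    have h := (mem_invForms_iff k p 𝔭 e _).mp hmem LinearMap.id
      (Literature.AlgebraicGeometry.Resolution.isDiffOpLE_id.of_le (Nat.zero_le _))
    have hform : addForm k p e (fun j => (LinearMap.id : k →ₗ[frobPow k p e] k) (v j)) = X i ^ p ^ e := by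
      unfold addForm
      rw [Finset.sum_eq_single i]
      · simp only [LinearMap.id_apply, hv, Pi.single_eq_same, C_1, one_mul]
      · intro j _ hj
        simp only [LinearMap.id_apply, hv, Pi.single_eq_of_ne hj, C_0, zero_mul]
      · intro hi; exact absurd (Finset.mem_univ i) hi
    rw [hform] at h
    exact hP.1.mem_of_pow_mem _ h
  have := Submodule.finrank_lt_finrank_of_lt hlt
  rw [finrank_top, Module.finrank_pi, Fintype.card_fin] at this
  omega

/-- The EXACT exponent: the least `e*` with `exponent ≤ e*`. [cite: Mizutani1973HironakaGroupSchemes, §1 (c) (the exponent e(Q))] -/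
theorem exists_exact_exponent {e₀ : ℕ} (hE₀ : ExponentLE k p 𝔭 e₀) :
    ∃ eStar, ExponentLE k p 𝔭 eStar ∧ (∀ j, j < eStar → ¬ ExponentLE k p 𝔭 j) ∧ eStar ≤ e₀ := by
  classical
  have hex : ∃ j, ExponentLE k p 𝔭 j := ⟨e₀, hE₀⟩
  exact ⟨Nat.find hex, Nat.find_spec hex, fun j hj => Nat.find_min hex hj, Nat.find_min' hex hE₀⟩

end Level

/-! ## Finite fields have no genuine tensors -/

section FiniteField

variable {k : Type u} [Field k] {p : ℕ} [Fact p.Prime] [CharP k p]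

/-- Over a finite field `k^{p^e} = k`, so the diagonal ideal of `k ⊗_{k^{p^e}} k` vanishes. [folklore] -/
theorem ideal_eq_bot_of_finite [Finite k] (e : ℕ) : KaehlerDifferential.ideal (frobPow k p e) k = ⊥ := by
  have hsurj : Function.Surjective fun y : k => y ^ p ^ e :=
    Finite.surjective_of_injective (pow_char_pow_injective (p := p) e)
  rw [← KaehlerDifferential.span_range_eq_ideal, Ideal.span_eq_bot]
  rintro _ ⟨y, rfl⟩
  obtain ⟨z, hz⟩ := hsurj y
  have hy : y = algebraMap (frobPow k p e) k ⟨y, mem_frobPow_iff.mpr ⟨z, hz⟩⟩ := rfl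
  beta_reduce
  rw [hy, sub_eq_zero]
  exact (Algebra.TensorProduct.tmul_one_eq_one_tmul _).symm

/-- A tensor in `J^{m+1}` outside some ideal forces `k` to be infinite. [folklore] -/
theorem infinite_of_mem_pow_not_mem {e m : ℕ} {ω : k ⊗[frobPow k p e] k}
    (hJ : ω ∈ KaehlerDifferential.ideal (frobPow k p e) k ^ (m + 1)) {I : Ideal (k ⊗[frobPow k p e] k)}
    (hI : ω ∉ I) : Infinite k := by
  by_contra hfin
  rw [not_infinite_iff_finite] at hfin
  apply hI
  rw [ideal_eq_bot_of_finite, ← Ideal.zero_eq_bot, zero_pow (Nat.succ_ne_zero m), Ideal.zero_eq_bot,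
    Ideal.mem_bot] at hJ
  rw [hJ]
  exact Ideal.zero_mem I

end FiniteField

/-! ## Passage to an intermediate field -/

section Incl

variable (K : Type*) {k : Type*} [Field K] [Field k] [Algebra K k]

/-- The inclusion `F ⊗_K F → k ⊗_K k` is injective (`F → k` has a `K`-linear retraction). [folklore] -/
theorem tensorIncl_injective (F : IntermediateField K k) : Function.Injective (tensorIncl K F) := by
  obtain ⟨r, hr⟩ := F.val.toLinearMap.exists_leftInverse_of_injective (LinearMap.ker_eq_bot.mpr F.val.injective)
  have hcomp : (TensorProduct.map r r).comp (TensorProduct.map F.val.toLinearMap F.val.toLinearMap) =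
      LinearMap.id := by
    rw [← TensorProduct.map_comp, hr, TensorProduct.map_id]
  intro x y hxy
  have := congrArg (TensorProduct.map r r) hxy
  have hx := congrArg (fun f : F ⊗[K] F →ₗ[K] F ⊗[K] F => f x) hcomp
  have hy := congrArg (fun f : F ⊗[K] F →ₗ[K] F ⊗[K] F => f y) hcomp
  simp only [LinearMap.comp_apply, LinearMap.id_apply] at hx hy
  rw [← hx, ← hy]
  exact this

variable {p : ℕ}

/-- The Frobenius-power ideal of `F ⊗_K F` maps into that of `k ⊗_K k`. [folklore] -/
theorem map_frobPowerIdeal_pow_le [Fact p.Prime] [CharP k p] (Ksub : Subfield k)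
    (F : IntermediateField Ksub k) (m : ℕ) :
    (frobPowerIdeal (L := Ksub) (K := F) p ^ m).map (tensorIncl Ksub F) ≤ frobIdeal k p Ksub ^ m := by
  rw [Ideal.map_pow]
  refine Ideal.pow_right_mono ?_ m
  unfold frobPowerIdeal frobIdeal
  rw [Ideal.map_span, Ideal.span_le]
  rintro _ ⟨_, ⟨y, rfl⟩, rfl⟩
  refine Ideal.subset_span ⟨(y : k), ?_⟩
  simp only [map_sub, Algebra.TensorProduct.map_tmul, map_one, map_pow, IntermediateField.coe_val]

end Incl

end Summit.ResolutionOfSingularities.KangarooAtlas.Mizutani
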